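import Literature.Topology.FourManifolds.LevelFlowExtension
import HarnessLib

/-!
# Lower pairs from a pair of level-shifting maps with related fields

Topic `Literature/Topology/FourManifolds` (fact seat
`provefact-Literature.Topology.FourManifolds.IsHandlebody.exists_diffeomorph_isBoundaryGluing_sphere`,
step F2b₁ of the Lickorish–Wallace DAG; level step H3 of the reduction of L1
`oneHandle_nonempty_diffeomorph`).  Everything here is **proved**; no named facts.

`IsLowerPair.of_maps` is `IsLowerPair.seed` (`LevelFlowExtension.lean`) for an abstract pair
of maps `g : M → M'`, `g' : M' → M` in place of the ambient maps of a diffeomorphism of sublevel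
sets: if `g`, `g'` are smooth below the levels `c + τ`, `c + σ + τ`, shift the levels by `σ`
there, are inverse to each other there, and the field of `M` is `g`-related to the (smooth)
field of `M'` on the collar `f⁻¹(c - τ, c + τ)` (which lies in the slab of `M`), then `(g, g')`
is a lower pair at the level `c + τ` of width `τ/3`: the flows are conjugated on the collar by
naturality of flows (`RelatedFlows.lean`; Lee 2013, Prop. 9.13), and the conjugation of the
inverse maps follows.  (The corrected seed of the handle-extension step — the ambient map of the
given diffeomorphism of sublevel sets followed by the suspension of a level diffeotopy — is such
a pair but not an ambient map of a diffeomorphism of the bundled sublevel sets.)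

## References

* J. Milnor, *Lectures on the h-cobordism theorem* (1965), proof of Thm. 3.13 (PDF pp. 18–19).
  [MilnorHCobordism1965]
* J. M. Lee, *Introduction to Smooth Manifolds*, 2nd ed. (2013), Prop. 9.13. [LeeSmoothManifolds2013]
-/

open scoped Manifold ContDiff Topology
open Set Function Filter

noncomputable section

namespace Literature.Topology.FourManifolds

universe u

variable {n : ℕ} {M : Type u} [TopologicalSpace M] [ChartedSpace (EuclideanHalfSpace (n + 1)) M]
  {M' : Type u} [TopologicalSpace M'] [ChartedSpace (EuclideanHalfSpace (n + 1)) M']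
  [IsManifold (𝓡∂ (n + 1)) ∞ M'] [T2Space M']
  (S : UnitSlab (n := n) M) (S' : UnitSlab (n := n) M')

/-- **A pair of level-shifting, mutually inverse maps with related fields on the collar is a
lower pair.** [cite: MilnorHCobordism1965, proof of Thm. 3.13 (PDF pp. 18–19)] -/
theorem IsLowerPair.of_maps {g : M → M'} {g' : M' → M} {σ c τ : ℝ} (hτ : 0 < τ)
    (hlo : S.lo ≤ c - τ) (hhi : c + τ ≤ S.hi)
    (hg : ∀ x, S.f x < c + τ → ContMDiffAt (𝓡∂ (n + 1)) (𝓡∂ (n + 1)) ∞ g x)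
    (hg' : ∀ y, S'.f y < c + σ + τ → ContMDiffAt (𝓡∂ (n + 1)) (𝓡∂ (n + 1)) ∞ g' y)
    (hlev : ∀ x, S.f x < c + τ → S'.f (g x) = S.f x + σ)
    (hlev' : ∀ y, S'.f y < c + σ + τ → S.f (g' y) = S'.f y - σ)
    (hinv : ∀ x, S.f x < c + τ → g' (g x) = x) (hinv' : ∀ y, S'.f y < c + σ + τ → g (g' y) = y)
    (hX' : ContMDiff (𝓡∂ (n + 1)) (𝓡∂ (n + 1)).tangent ∞ fun y => (⟨y, S'.X y⟩ : TangentBundle (𝓡∂ (n + 1)) M'))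
    (hrel : ∀ x, S.f x ∈ Ioo (c - τ) (c + τ) →
      mfderiv (𝓡∂ (n + 1)) (𝓡∂ (n + 1)) g x (S.X x) = S'.X (g x)) :
    IsLowerPair S S' σ (c + τ) (τ / 3) g g' := by
  -- conjugation of the flows on the collar, by naturality of flows
  have hflow : ∀ x t, S.f x ∈ Ioo (c - τ) (c + τ) → S.f x + t ∈ Ioo (c - τ) (c + τ) →
      g (S.θ (t, x)) = S'.θ (t, g x) := by
    intro x t hx ht
    have h1inf : (1 : ℕ∞ω) ≤ ∞ := by exact_mod_cast le_top
    haveI : IsManifold (𝓡∂ (n + 1)) 1 M' := IsManifold.of_le (n := ∞) h1inf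
    have hU : IsOpen {x : M | S.f x ∈ Ioo (c - τ) (c + τ)} := isOpen_Ioo.preimage S.hf.continuous
    have hgU : ContMDiffOn (𝓡∂ (n + 1)) (𝓡∂ (n + 1)) 1 g {x : M | S.f x ∈ Ioo (c - τ) (c + τ)} :=
      fun y hy => ((hg y hy.2).of_le h1inf).contMDiffWithinAt
    have hxs : S.f x ∈ Ioo S.lo S.hi := ⟨by linarith [hx.1], by linarith [hx.2]⟩
    have hmem : ∀ s, s ∈ Icc (min t 0) (max t 0) → S.θ (s, x) ∈ {x : M | S.f x ∈ Ioo (c - τ) (c + τ)} := by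
      intro s hs
      have hs' : S.f x + s ∈ Ioo (c - τ) (c + τ) := by
        rcases le_total 0 t with h0 | h0
        · rw [min_eq_right h0, max_eq_left h0] at hs
          exact ⟨by linarith [hx.1, hs.1], by linarith [ht.2, hs.2]⟩
        · rw [min_eq_left h0, max_eq_right h0] at hs
          exact ⟨by linarith [ht.1, hs.1], by linarith [hx.2, hs.2]⟩
      show S.f (S.θ (s, x)) ∈ Ioo (c - τ) (c + τ)
      rw [S.apply_flow hxs ⟨by linarith [hs'.1], by linarith [hs'.2]⟩]; exact hs'
    exact S.isFlowOf.apply_eq_of_mfderiv_eq_of_Icc S'.isFlowOf (hX'.of_le h1inf) hU hgU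
      (fun y hy => hrel y hy) (min_le_right _ _) (le_max_right _ _) hmem ⟨min_le_left _ _, le_max_left _ _⟩
  refine
    { g_smooth := fun x hx => (hg x hx).contMDiffWithinAt
      g'_smooth := fun y hy => (hg' y (by have hy' : S'.f y < c + τ + σ := hy; linarith)).contMDiffWithinAt
      apply_g := fun x hx => hlev x hx.2
      apply_g' := fun y hy => hlev' y (by linarith [hy.2])
      g_below := fun x hx => by rw [hlev x (by linarith)]; linarith
      g'_below := fun y hy => by rw [hlev' y (by linarith)]; linarith
      g'_g := fun x hx => hinv x hx
      g_g' := fun y hy => hinv' y (by have hy' : S'.f y < c + τ + σ := hy; linarith)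
      g_flow := fun x t hx ht => hflow x t ⟨by linarith [hx.1], by linarith [hx.2]⟩
        ⟨by linarith [ht.1], by linarith [ht.2]⟩
      g'_flow := fun y t hy ht => ?_ }
  -- conjugation of the inverse maps, from that of the maps
  have hy' : S'.f y < c + σ + τ := by linarith [hy.2]
  have hx : S.f (g' y) = S'.f y - σ := hlev' y hy'
  have h1 := hflow (g' y) t (by rw [hx]; constructor <;> linarith [hy.1, hy.2])
    (by rw [hx]; constructor <;> linarith [ht.1, ht.2])
  rw [hinv' y hy'] at h1
  have hlt : S.f (S.θ (t, g' y)) < c + τ := by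
    have hxs : S.f (g' y) ∈ Ioo S.lo S.hi := by rw [hx]; constructor <;> linarith [hy.1, hy.2]
    rw [S.apply_flow hxs (by rw [hx]; constructor <;> linarith [ht.1, ht.2]), hx]
    linarith [ht.2]
  rw [← h1]
  exact hinv _ hlt

end Literature.Topology.FourManifolds
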